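import Summits.ABC.ABC.Theses.IneffectiveSubspace
import Literature.NumberTheory.DiophantineGeometry.AbcImpliesHall

/-!
# `TowerExponentWindow` (stmt-ABC-1647) — negative-side lemmas II: floors for the lever of line
`binomial-xi-d-zero-threefold` (registered stub `stub_binomialDepthWindow`)

Standing-adversary (cdisprove, gen 2) output for the crux
`Summit.ABC.ABC.Theses.IneffectiveSubspace.TowerExponentWindow`, `-- Targets` part.  The lead's line
(`Cruxes/TowerExponentWindow/Lines/binomial-xi-d-zero-threefold.lean`) reduces the crux to ONE open stub, the
binomial depth inequality: `∃ n, ∃ C C', 0 ≤ C ∧ 3C < n ∧ Depth(n, C, C')`, where `Depth(n, C, C')` says that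
for positive `a₁ a₂ c₁ c₂` with `gcd(a₁a₂, c₁c₂) = 1`, `a₁a₂ⁿ ≠ c₁c₂ⁿ`, every positive divisor `d` of
`a₁a₂ⁿ − c₁c₂ⁿ` has `log d ≤ C·(log max(a₁,c₁) + log max(a₂,c₂) + log rad d) + C'` (spelled out verbatim in
every statement below; no auxiliary definitions).  The stub is implied by abc (skeleton:
`binomialDepthWindow_of_abc`), so it cannot be refuted outright; proved here is WHERE it can live:

* `depth_floor_of_families` — engine: admissible families with depth `≥ p·s` against heights `≤ q·s + r`,
  `s → ∞`, force `p ≤ C·q`;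
* `one_le_of_depth` — **`C ≥ 1` at every level** (`a₁ = 2^(m+1) + 1`, `d = 2^(m+1)`), so levels `n ≤ 3` are
  vacuous (`four_le_of_depth_window`);
* `two_le_of_depth_four_dvd` — **`C ≥ 2` at every level divisible by `4`**: Gaussian family
  `(2 + i)^m = X + iY`, `X² + Y² = 5^m ∣ X⁴ − Y⁴`, `|X|, |Y| ≤ 5^(m/2)` (`gaussian_point`);
* `two_le_of_depth_six_dvd` — **`C ≥ 2` at every level divisible by `6`**: Eisenstein family
  `(3 + ω)^m = X + Yω`, `X² − XY + Y² = 7^m ∣ X⁶ − Y⁶`, `3X², 3Y² ≤ 4·7^m` (`eisenstein_point`);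
* companion file `StubBinomialDepthWindowLevelSeven`: `C ≥ 9/5` at level `5` (Padé family) and the
  consequence that **any witness of the stub has level `n ≥ 7`**.  Heuristically (birthday count of
  `a₁a₂ⁿ ≡ c₁c₂ⁿ mod q^m` in boxes) the true threshold is `C = 2` at every level, matching
  `ABC ⟹ Depth(n, 2 + (n+2)ε, C')` (skeleton, `binomialDepthWindow_of_abc`).

Refuter seat cdisprove-stmt-ABC-1647 (gen 2), 2026-08-16; work file `Cruxes/TowerExponentWindow/Disproof.lean`.
-/

namespace Summit.ABC.ABC.Theorems.TowerExponentWindow.Negative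

open Literature.NumberTheory.DiophantineGeometry (radical_le_of_dvd_pow)

/-! ## Engine -/

/-- **Floor engine.** If the level-`n` depth inequality holds with constants `(C, C')`, `0 ≤ C`, and for
every `m` there are admissible data with depth `log d ≥ p·s_m` and heights
`log max₁ + log max₂ + log rad d ≤ q·s_m + r`, where `s` is unbounded, then `p ≤ C·q`. [folklore] -/
theorem depth_floor_of_families {n : ℕ} {C C' : ℝ} (hC : 0 ≤ C)
    (h : ∀ a₁ a₂ c₁ c₂ : ℕ, 0 < a₁ → 0 < a₂ → 0 < c₁ → 0 < c₂ → Nat.Coprime (a₁ * a₂) (c₁ * c₂) →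
      a₁ * a₂ ^ n ≠ c₁ * c₂ ^ n → ∀ d : ℕ, 0 < d → (d : ℤ) ∣ ((a₁ * a₂ ^ n : ℕ) : ℤ) - ((c₁ * c₂ ^ n : ℕ) : ℤ) →
      Real.log (d : ℝ) ≤ C * (Real.log ((max a₁ c₁ : ℕ) : ℝ) + Real.log ((max a₂ c₂ : ℕ) : ℝ) +
        Real.log ((UniqueFactorizationMonoid.radical d : ℕ) : ℝ)) + C')
    {p q r : ℝ} (s : ℕ → ℝ) (hunb : ∀ K : ℝ, ∃ m, K ≤ s m)
    (hfam : ∀ m, ∃ a₁ a₂ c₁ c₂ d : ℕ, 0 < a₁ ∧ 0 < a₂ ∧ 0 < c₁ ∧ 0 < c₂ ∧ 0 < d ∧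
      Nat.Coprime (a₁ * a₂) (c₁ * c₂) ∧ a₁ * a₂ ^ n ≠ c₁ * c₂ ^ n ∧
      (d : ℤ) ∣ ((a₁ * a₂ ^ n : ℕ) : ℤ) - ((c₁ * c₂ ^ n : ℕ) : ℤ) ∧
      p * s m ≤ Real.log (d : ℝ) ∧
      Real.log ((max a₁ c₁ : ℕ) : ℝ) + Real.log ((max a₂ c₂ : ℕ) : ℝ) +
        Real.log ((UniqueFactorizationMonoid.radical d : ℕ) : ℝ) ≤ q * s m + r) :
    p ≤ C * q := by
  by_contra hlt
  have hg : 0 < p - C * q := by linarith [lt_of_not_ge hlt]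
  obtain ⟨m, hm⟩ := hunb ((C * r + C' + 1) / (p - C * q))
  obtain ⟨a₁, a₂, c₁, c₂, d, ha₁, ha₂, hc₁, hc₂, hd, hcop, hne, hdvd, hlow, hupp⟩ := hfam m
  have h1 := h a₁ a₂ c₁ c₂ ha₁ ha₂ hc₁ hc₂ hcop hne d hd hdvd
  have h2 : p * s m ≤ C * (q * s m + r) + C' :=
    hlow.trans (h1.trans (by nlinarith [mul_le_mul_of_nonneg_left hupp hC]))
  have h4 : C * r + C' + 1 ≤ (p - C * q) * s m := by
    have := (div_le_iff₀ hg).mp hm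
    linarith
  nlinarith

/-! ## Floor `1` at every level -/

/-- **`C ≥ 1` at every level**: the data `a₁ = 2^(m+1) + 1`, `a₂ = c₁ = c₂ = 1`, `d = 2^(m+1)` have depth
`(m+1) log 2` against heights `≤ (m+2) log 2 + 0 + log 2`. [folklore] -/
theorem one_le_of_depth {n : ℕ} {C C' : ℝ} (hC : 0 ≤ C)
    (h : ∀ a₁ a₂ c₁ c₂ : ℕ, 0 < a₁ → 0 < a₂ → 0 < c₁ → 0 < c₂ → Nat.Coprime (a₁ * a₂) (c₁ * c₂) →
      a₁ * a₂ ^ n ≠ c₁ * c₂ ^ n → ∀ d : ℕ, 0 < d → (d : ℤ) ∣ ((a₁ * a₂ ^ n : ℕ) : ℤ) - ((c₁ * c₂ ^ n : ℕ) : ℤ) →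
      Real.log (d : ℝ) ≤ C * (Real.log ((max a₁ c₁ : ℕ) : ℝ) + Real.log ((max a₂ c₂ : ℕ) : ℝ) +
        Real.log ((UniqueFactorizationMonoid.radical d : ℕ) : ℝ)) + C') :
    1 ≤ C := by
  have hlog2 : 0 < Real.log 2 := Real.log_pos one_lt_two
  have key := depth_floor_of_families hC h (p := 1) (q := 1) (r := 2 * Real.log 2)
    (fun m => ((m : ℝ) + 1) * Real.log 2) (fun K => ?_) (fun m => ?_)
  · linarith
  · obtain ⟨m, hm⟩ := exists_nat_ge (K / Real.log 2)
    refine ⟨m, ?_⟩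
    have := (div_le_iff₀ hlog2).mp hm
    nlinarith
  · refine ⟨2 ^ (m + 1) + 1, 1, 1, 1, 2 ^ (m + 1), by positivity, one_pos, one_pos, one_pos,
      by positivity, by simp, by simp, by push_cast; simp, ?_, ?_⟩
    · push_cast
      rw [Real.log_pow]; push_cast; linarith
    · have e1 : (max (2 ^ (m + 1) + 1) 1 : ℕ) = 2 ^ (m + 1) + 1 := max_eq_left (Nat.le_add_left 1 _)
      have e2 : (max 1 1 : ℕ) = 1 := max_self 1
      rw [e1, e2]
      have hrad : UniqueFactorizationMonoid.radical (2 ^ (m + 1)) ≤ 2 :=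
        radical_le_of_dvd_pow (n := m + 1) two_ne_zero dvd_rfl
      have hrad' : Real.log ((UniqueFactorizationMonoid.radical (2 ^ (m + 1)) : ℕ) : ℝ) ≤ Real.log 2 :=
        Real.log_le_log (by exact_mod_cast Nat.radical_pos _) (by exact_mod_cast hrad)
      have hm1 : Real.log ((2 ^ (m + 1) + 1 : ℕ) : ℝ) ≤ ((m : ℝ) + 2) * Real.log 2 := by
        have hle : ((2 ^ (m + 1) + 1 : ℕ) : ℝ) ≤ (2 : ℝ) ^ (m + 2) := by
          have : 2 ^ (m + 1) + 1 ≤ 2 ^ (m + 2) := by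
            have hx : 1 ≤ 2 ^ (m + 1) := Nat.one_le_two_pow
            rw [pow_succ 2 (m + 1)]; omega
          exact_mod_cast this
        calc Real.log ((2 ^ (m + 1) + 1 : ℕ) : ℝ) ≤ Real.log ((2 : ℝ) ^ (m + 2)) :=
              Real.log_le_log (by positivity) hle
          _ = ((m : ℝ) + 2) * Real.log 2 := by rw [Real.log_pow]; push_cast; ring
      push_cast at hm1 ⊢
      rw [Real.log_one]
      linarith

/-- The lever cannot be witnessed at a level `n ≤ 3`. [folklore] -/
theorem four_le_of_depth_window {n : ℕ} {C C' : ℝ} (hC : 0 ≤ C) (h3 : 3 * C < n)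
    (h : ∀ a₁ a₂ c₁ c₂ : ℕ, 0 < a₁ → 0 < a₂ → 0 < c₁ → 0 < c₂ → Nat.Coprime (a₁ * a₂) (c₁ * c₂) →
      a₁ * a₂ ^ n ≠ c₁ * c₂ ^ n → ∀ d : ℕ, 0 < d → (d : ℤ) ∣ ((a₁ * a₂ ^ n : ℕ) : ℤ) - ((c₁ * c₂ ^ n : ℕ) : ℤ) →
      Real.log (d : ℝ) ≤ C * (Real.log ((max a₁ c₁ : ℕ) : ℝ) + Real.log ((max a₂ c₂ : ℕ) : ℝ) +
        Real.log ((UniqueFactorizationMonoid.radical d : ℕ) : ℝ)) + C') :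
    4 ≤ n := by
  have h1 := one_le_of_depth hC h
  by_contra hlt
  have : (n : ℝ) ≤ 3 := by exact_mod_cast (by omega : n ≤ 3)
  linarith

/-! ## Floor `2` at the levels divisible by `4`: the Gaussian family -/

/-- `(2 + i)^m = X + iY`: `X² + Y² = 5^m` and `X + 2Y ≢ 0 (mod 5)` (the invariant is multiplied by `4` at
each step `(X, Y) ↦ (2X − Y, X + 2Y)`). [folklore] -/
theorem gaussian_family (m : ℕ) : ∃ X Y : ℤ, X ^ 2 + Y ^ 2 = 5 ^ m ∧ ¬ (5 : ℤ) ∣ X + 2 * Y := by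
  induction m with
  | zero => exact ⟨1, 0, by norm_num, by decide⟩
  | succ m ih =>
    have prime_five_int : Prime (5 : ℤ) := Int.prime_iff_natAbs_prime.mpr (by norm_num)
    obtain ⟨X, Y, hn, hi⟩ := ih
    refine ⟨2 * X - Y, X + 2 * Y, by rw [pow_succ]; linear_combination 5 * hn, fun h => hi ?_⟩
    have h4 : (5 : ℤ) ∣ 4 * (X + 2 * Y) := by
      have e : 4 * (X + 2 * Y) = (2 * X - Y + 2 * (X + 2 * Y)) + 5 * Y := by ring
      rw [e]; exact dvd_add h (dvd_mul_right 5 _)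
    rcases prime_five_int.dvd_or_dvd h4 with h' | h'
    · exact absurd h' (by decide)
    · exact h'

/-- For `m ≥ 1` the Gaussian point has `X, Y ≠ 0`, `|X| ≠ |Y|`, `gcd(X, Y) = 1`, `X², Y² ≤ 5^m`. [folklore] -/
theorem gaussian_point {m : ℕ} (hm : 1 ≤ m) : ∃ X Y : ℤ, X ^ 2 + Y ^ 2 = 5 ^ m ∧ X ≠ 0 ∧ Y ≠ 0 ∧
    X.natAbs ≠ Y.natAbs ∧ Nat.Coprime X.natAbs Y.natAbs ∧ X.natAbs ^ 2 ≤ 5 ^ m ∧ Y.natAbs ^ 2 ≤ 5 ^ m := by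
  have prime_five_int : Prime (5 : ℤ) := Int.prime_iff_natAbs_prime.mpr (by norm_num)
  obtain ⟨X, Y, hn, hi⟩ := gaussian_family m
  have h5m : (5 : ℤ) ∣ 5 ^ m := dvd_pow_self 5 (by omega)
  refine ⟨X, Y, hn, fun h0 => hi ?_, fun h0 => hi ?_, fun h => ?_, ?_, ?_, ?_⟩
  · have h5 : (5 : ℤ) ∣ Y ^ 2 := by rw [← hn, h0] at h5m; simpa using h5m
    rw [h0, zero_add]; exact dvd_mul_of_dvd_right (prime_five_int.dvd_of_dvd_pow h5) 2
  · have h5 : (5 : ℤ) ∣ X ^ 2 := by rw [← hn, h0] at h5m; simpa using h5m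
    rw [h0, mul_zero, add_zero]; exact prime_five_int.dvd_of_dvd_pow h5
  · have hsq : X ^ 2 = Y ^ 2 := by rw [← Int.natAbs_sq X, ← Int.natAbs_sq Y, h]
    rw [hsq] at hn
    have hodd : Odd ((5 : ℤ) ^ m) := Odd.pow (by decide)
    rw [← hn] at hodd
    exact Int.not_even_iff_odd.mpr hodd ⟨Y ^ 2, rfl⟩
  · show Int.gcd X Y = 1
    set g : ℕ := Int.gcd X Y with hg
    have hgX : (g : ℤ) ∣ X := Int.gcd_dvd_left ..
    have hgY : (g : ℤ) ∣ Y := Int.gcd_dvd_right ..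
    have hg5 : g ∣ 5 ^ m := by
      have h1 : (g : ℤ) ∣ 5 ^ m := by
        rw [← hn]; exact dvd_add (dvd_pow hgX two_ne_zero) (dvd_pow hgY two_ne_zero)
      exact_mod_cast h1
    obtain ⟨k, hk, hgk⟩ := (Nat.dvd_prime_pow Nat.prime_five).mp hg5
    rcases Nat.eq_zero_or_pos k with hk0 | hk0
    · rw [hgk, hk0, pow_zero]
    · exfalso
      have h5g : (5 : ℤ) ∣ (g : ℤ) := by rw [hgk]; push_cast; exact dvd_pow_self 5 hk0.ne'
      exact hi (dvd_add (h5g.trans hgX) (dvd_mul_of_dvd_right (h5g.trans hgY) 2))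
  · have h1 : ((X.natAbs : ℤ)) ^ 2 ≤ 5 ^ m := by rw [Int.natAbs_sq]; nlinarith [sq_nonneg Y]
    exact_mod_cast h1
  · have h1 : ((Y.natAbs : ℤ)) ^ 2 ≤ 5 ^ m := by rw [Int.natAbs_sq]; nlinarith [sq_nonneg X]
    exact_mod_cast h1

/-- **`C ≥ 2` at every level `n = 4k ≥ 4`**: data `a₁ = c₁ = 1`, `a₂ = |X|`, `c₂ = |Y|`, `d = 5^m` from the
Gaussian point (`5^m = X² + Y² ∣ X⁴ − Y⁴ ∣ Xⁿ − Yⁿ`), depth `m log 5` against heights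
`0 + (m/2) log 5 + log 5`.  So the lever is unsatisfiable at level `4`. [folklore] -/
theorem two_le_of_depth_four_dvd {n : ℕ} (hn : n ≠ 0) (h4 : 4 ∣ n) {C C' : ℝ} (hC : 0 ≤ C)
    (h : ∀ a₁ a₂ c₁ c₂ : ℕ, 0 < a₁ → 0 < a₂ → 0 < c₁ → 0 < c₂ → Nat.Coprime (a₁ * a₂) (c₁ * c₂) →
      a₁ * a₂ ^ n ≠ c₁ * c₂ ^ n → ∀ d : ℕ, 0 < d → (d : ℤ) ∣ ((a₁ * a₂ ^ n : ℕ) : ℤ) - ((c₁ * c₂ ^ n : ℕ) : ℤ) →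
      Real.log (d : ℝ) ≤ C * (Real.log ((max a₁ c₁ : ℕ) : ℝ) + Real.log ((max a₂ c₂ : ℕ) : ℝ) +
        Real.log ((UniqueFactorizationMonoid.radical d : ℕ) : ℝ)) + C') :
    2 ≤ C := by
  obtain ⟨k, rfl⟩ := h4
  have hlog5 : 0 < Real.log 5 := Real.log_pos (by norm_num)
  have key := depth_floor_of_families hC h (p := 1) (q := 1 / 2) (r := Real.log 5)
    (fun m => ((m : ℝ) + 1) * Real.log 5) (fun K => ?_) (fun m => ?_)
  · linarith
  · obtain ⟨m, hm⟩ := exists_nat_ge (K / Real.log 5)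
    refine ⟨m, ?_⟩
    have := (div_le_iff₀ hlog5).mp hm
    nlinarith
  · obtain ⟨X, Y, hnorm, hX0, hY0, hne, hcop, hX, hY⟩ := gaussian_point (m := m + 1) (by omega)
    refine ⟨1, X.natAbs, 1, Y.natAbs, 5 ^ (m + 1), one_pos, Int.natAbs_pos.mpr hX0, one_pos,
      Int.natAbs_pos.mpr hY0, by positivity, by simpa using hcop, ?_, ?_, ?_, ?_⟩
    · rw [one_mul, one_mul]
      exact fun he => hne (Nat.pow_left_injective (by omega) he)
    · push_cast
      rw [show 4 * k = 2 * (2 * k) by ring, pow_mul, pow_mul |Y|, sq_abs, sq_abs, ← pow_mul, ← pow_mul,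
        show 2 * (2 * k) = 4 * k by ring, one_mul, one_mul]
      have h1 : (5 : ℤ) ^ (m + 1) ∣ X ^ 4 - Y ^ 4 := ⟨X ^ 2 - Y ^ 2, by rw [← hnorm]; ring⟩
      have h2 : X ^ 4 - Y ^ 4 ∣ (X ^ 4) ^ k - (Y ^ 4) ^ k := sub_dvd_pow_sub_pow _ _ k
      rw [pow_mul, pow_mul]
      exact h1.trans h2
    · push_cast
      rw [Real.log_pow]; push_cast; linarith
    · set M : ℕ := max X.natAbs Y.natAbs with hM
      have hM2 : M ^ 2 ≤ 5 ^ (m + 1) := by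
        rcases le_total X.natAbs Y.natAbs with hle | hle
        · rw [hM, max_eq_right hle]; exact hY
        · rw [hM, max_eq_left hle]; exact hX
      have hM1 : 1 ≤ M := le_max_of_le_left (Int.natAbs_pos.mpr hX0)
      have hlogM : 2 * Real.log (M : ℝ) ≤ ((m : ℝ) + 1) * Real.log 5 := by
        have h1 : ((M : ℕ) : ℝ) ^ 2 ≤ (5 : ℝ) ^ (m + 1) := by exact_mod_cast hM2
        have h2 := Real.log_le_log (by positivity) h1
        rw [Real.log_pow, Real.log_pow] at h2
        push_cast at h2
        linarith
      have hrad : UniqueFactorizationMonoid.radical (5 ^ (m + 1)) ≤ 5 :=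
        radical_le_of_dvd_pow (n := m + 1) (by norm_num) dvd_rfl
      have hrad' : Real.log ((UniqueFactorizationMonoid.radical (5 ^ (m + 1)) : ℕ) : ℝ) ≤ Real.log 5 :=
        Real.log_le_log (by exact_mod_cast Nat.radical_pos _) (by exact_mod_cast hrad)
      push_cast
      rw [max_self, Real.log_one]
      linarith


/-! ## Floor `2` at the levels divisible by `6`: the Eisenstein family -/

/-- `(3 + ω)^m = X + Yω` (`ω² + ω + 1 = 0`): `X² − XY + Y² = 7^m` and `X + 2Y ≢ 0 (mod 7)` (the invariant is
multiplied by `5` at each step `(X, Y) ↦ (3X − Y, X + 2Y)`). [folklore] -/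
theorem eisenstein_family (m : ℕ) :
    ∃ X Y : ℤ, X ^ 2 - X * Y + Y ^ 2 = 7 ^ m ∧ ¬ (7 : ℤ) ∣ X + 2 * Y := by
  induction m with
  | zero => exact ⟨1, 0, by norm_num, by decide⟩
  | succ m ih =>
    have prime_seven_int : Prime (7 : ℤ) := Int.prime_iff_natAbs_prime.mpr (by norm_num)
    obtain ⟨X, Y, hn, hi⟩ := ih
    refine ⟨3 * X - Y, X + 2 * Y, by rw [pow_succ]; linear_combination 7 * hn, fun h => hi ?_⟩
    have h5 : (7 : ℤ) ∣ 5 * (X + 2 * Y) := by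
      have e : 5 * (X + 2 * Y) = (3 * X - Y + 2 * (X + 2 * Y)) + 7 * Y := by ring
      rw [e]; exact dvd_add h (dvd_mul_right 7 _)
    rcases prime_seven_int.dvd_or_dvd h5 with h' | h'
    · exact absurd h' (by decide)
    · exact h'

/-- For `m ≥ 1` the Eisenstein point has `X, Y ≠ 0`, `|X| ≠ |Y|`, `gcd(X, Y) = 1`, `3X², 3Y² ≤ 4·7^m`.
[folklore] -/
theorem eisenstein_point {m : ℕ} (hm : 1 ≤ m) : ∃ X Y : ℤ, X ^ 2 - X * Y + Y ^ 2 = 7 ^ m ∧ X ≠ 0 ∧ Y ≠ 0 ∧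
    X.natAbs ≠ Y.natAbs ∧ Nat.Coprime X.natAbs Y.natAbs ∧
    3 * X.natAbs ^ 2 ≤ 4 * 7 ^ m ∧ 3 * Y.natAbs ^ 2 ≤ 4 * 7 ^ m := by
  have prime_seven_int : Prime (7 : ℤ) := Int.prime_iff_natAbs_prime.mpr (by norm_num)
  obtain ⟨X, Y, hn, hi⟩ := eisenstein_family m
  have h7m : (7 : ℤ) ∣ 7 ^ m := dvd_pow_self 7 (by omega)
  refine ⟨X, Y, hn, fun h0 => hi ?_, fun h0 => hi ?_, fun h => ?_, ?_, ?_, ?_⟩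
  · have h7 : (7 : ℤ) ∣ Y ^ 2 := by rw [← hn, h0] at h7m; simpa using h7m
    rw [h0, zero_add]; exact dvd_mul_of_dvd_right (prime_seven_int.dvd_of_dvd_pow h7) 2
  · have h7 : (7 : ℤ) ∣ X ^ 2 := by rw [← hn, h0] at h7m; simpa using h7m
    rw [h0, mul_zero, add_zero]; exact prime_seven_int.dvd_of_dvd_pow h7
  · rcases Int.natAbs_eq_natAbs_iff.mp h with h' | h'
    · rw [h'] at hn hi
      have h7 : (7 : ℤ) ∣ Y ^ 2 := by rw [← hn] at h7m; convert h7m using 1; ring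
      have h7Y := prime_seven_int.dvd_of_dvd_pow h7
      exact hi (dvd_add h7Y (dvd_mul_of_dvd_right h7Y 2))
    · rw [h'] at hn
      have h3 : (3 : ℤ) ∣ 7 ^ m := ⟨Y ^ 2, by rw [← hn]; ring⟩
      have h37 : (3 : ℤ) ∣ 7 :=
        (Int.prime_iff_natAbs_prime.mpr (by norm_num) : Prime (3 : ℤ)).dvd_of_dvd_pow h3
      revert h37; decide
  · show Int.gcd X Y = 1
    set g : ℕ := Int.gcd X Y with hg
    have hgX : (g : ℤ) ∣ X := Int.gcd_dvd_left ..
    have hgY : (g : ℤ) ∣ Y := Int.gcd_dvd_right ..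
    have hg7 : g ∣ 7 ^ m := by
      have h1 : (g : ℤ) ∣ 7 ^ m := by
        rw [← hn]
        exact dvd_add (dvd_sub (dvd_pow hgX two_ne_zero) (dvd_mul_of_dvd_left hgX _)) (dvd_pow hgY two_ne_zero)
      exact_mod_cast h1
    obtain ⟨k, hk, hgk⟩ := (Nat.dvd_prime_pow (by norm_num : Nat.Prime 7)).mp hg7
    rcases Nat.eq_zero_or_pos k with hk0 | hk0
    · rw [hgk, hk0, pow_zero]
    · exfalso
      have h7g : (7 : ℤ) ∣ (g : ℤ) := by rw [hgk]; push_cast; exact dvd_pow_self 7 hk0.ne'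
      exact hi (dvd_add (h7g.trans hgX) (dvd_mul_of_dvd_right (h7g.trans hgY) 2))
  · have h1 : 3 * ((X.natAbs : ℤ)) ^ 2 ≤ 4 * 7 ^ m := by
      rw [Int.natAbs_sq]; nlinarith [sq_nonneg (2 * Y - X)]
    exact_mod_cast h1
  · have h1 : 3 * ((Y.natAbs : ℤ)) ^ 2 ≤ 4 * 7 ^ m := by
      rw [Int.natAbs_sq]; nlinarith [sq_nonneg (2 * X - Y)]
    exact_mod_cast h1

/-- **`C ≥ 2` at every level `n = 6k ≥ 6`**: data `a₁ = c₁ = 1`, `a₂ = |X|`, `c₂ = |Y|`, `d = 7^m` from the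
Eisenstein point (`7^m = X² − XY + Y² ∣ X⁶ − Y⁶ ∣ Xⁿ − Yⁿ`), depth `m log 7` against heights
`0 + (m/2) log 7 + O(1) + log 7`.  So the lever is unsatisfiable at level `6`. [folklore] -/
theorem two_le_of_depth_six_dvd {n : ℕ} (hn : n ≠ 0) (h6 : 6 ∣ n) {C C' : ℝ} (hC : 0 ≤ C)
    (h : ∀ a₁ a₂ c₁ c₂ : ℕ, 0 < a₁ → 0 < a₂ → 0 < c₁ → 0 < c₂ → Nat.Coprime (a₁ * a₂) (c₁ * c₂) →
      a₁ * a₂ ^ n ≠ c₁ * c₂ ^ n → ∀ d : ℕ, 0 < d → (d : ℤ) ∣ ((a₁ * a₂ ^ n : ℕ) : ℤ) - ((c₁ * c₂ ^ n : ℕ) : ℤ) →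
      Real.log (d : ℝ) ≤ C * (Real.log ((max a₁ c₁ : ℕ) : ℝ) + Real.log ((max a₂ c₂ : ℕ) : ℝ) +
        Real.log ((UniqueFactorizationMonoid.radical d : ℕ) : ℝ)) + C') :
    2 ≤ C := by
  obtain ⟨k, rfl⟩ := h6
  have hlog7 : 0 < Real.log 7 := Real.log_pos (by norm_num)
  have key := depth_floor_of_families hC h (p := 1) (q := 1 / 2) (r := Real.log 2 + Real.log 7)
    (fun m => ((m : ℝ) + 1) * Real.log 7) (fun K => ?_) (fun m => ?_)
  · linarith
  · obtain ⟨m, hm⟩ := exists_nat_ge (K / Real.log 7)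
    refine ⟨m, ?_⟩
    have := (div_le_iff₀ hlog7).mp hm
    nlinarith
  · obtain ⟨X, Y, hnorm, hX0, hY0, hne, hcop, hX, hY⟩ := eisenstein_point (m := m + 1) (by omega)
    refine ⟨1, X.natAbs, 1, Y.natAbs, 7 ^ (m + 1), one_pos, Int.natAbs_pos.mpr hX0, one_pos,
      Int.natAbs_pos.mpr hY0, by positivity, by simpa using hcop, ?_, ?_, ?_, ?_⟩
    · rw [one_mul, one_mul]
      exact fun he => hne (Nat.pow_left_injective (by omega) he)
    · push_cast
      rw [show 6 * k = 2 * (3 * k) by ring, pow_mul, pow_mul |Y|, sq_abs, sq_abs, ← pow_mul, ← pow_mul,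
        show 2 * (3 * k) = 6 * k by ring, one_mul, one_mul]
      have h1 : (7 : ℤ) ^ (m + 1) ∣ X ^ 6 - Y ^ 6 := ⟨(X + Y) * (X ^ 3 - Y ^ 3), by rw [← hnorm]; ring⟩
      have h2 : X ^ 6 - Y ^ 6 ∣ (X ^ 6) ^ k - (Y ^ 6) ^ k := sub_dvd_pow_sub_pow _ _ k
      rw [pow_mul, pow_mul]
      exact h1.trans h2
    · push_cast
      rw [Real.log_pow]; push_cast; linarith
    · set M : ℕ := max X.natAbs Y.natAbs with hM
      have hM2 : 3 * M ^ 2 ≤ 4 * 7 ^ (m + 1) := by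
        rcases le_total X.natAbs Y.natAbs with hle | hle
        · rw [hM, max_eq_right hle]; exact hY
        · rw [hM, max_eq_left hle]; exact hX
      have hM1 : 1 ≤ M := le_max_of_le_left (Int.natAbs_pos.mpr hX0)
      have hlogM : 2 * Real.log (M : ℝ) ≤ ((m : ℝ) + 1) * Real.log 7 + Real.log 2 := by
        have h1 : ((M : ℕ) : ℝ) ^ 2 ≤ 2 * (7 : ℝ) ^ (m + 1) := by
          have h' : ((3 * M ^ 2 : ℕ) : ℝ) ≤ ((4 * 7 ^ (m + 1) : ℕ) : ℝ) := by exact_mod_cast hM2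
          push_cast at h'
          nlinarith [h']
        have h2 := Real.log_le_log (by positivity) h1
        rw [Real.log_pow, Real.log_mul (by norm_num) (by positivity), Real.log_pow] at h2
        push_cast at h2
        linarith
      have hrad : UniqueFactorizationMonoid.radical (7 ^ (m + 1)) ≤ 7 :=
        radical_le_of_dvd_pow (n := m + 1) (by norm_num) dvd_rfl
      have hrad' : Real.log ((UniqueFactorizationMonoid.radical (7 ^ (m + 1)) : ℕ) : ℝ) ≤ Real.log 7 :=
        Real.log_le_log (by exact_mod_cast Nat.radical_pos _) (by exact_mod_cast hrad)
      have hlog2 : 0 ≤ Real.log 2 := Real.log_nonneg (by norm_num)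
      push_cast
      rw [max_self, Real.log_one]
      linarith

end Summit.ABC.ABC.Theorems.TowerExponentWindow.Negative
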